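import Summits.HubbardSuperconductivity.HubbardSuperconductivity.Theorems.AnisotropyChordTransferTwoBlock
import Summits.HubbardSuperconductivity.HubbardSuperconductivity.Theorems.AnisotropyChordTransferRotatedPackage

/-!
# Route `AnisotropyChord` / H0 rotor rung, route (1): **THEOREM L1 (level-one ordering) and THEOREM Z⁺ with uniqueness, on the even torus**

Theory seat `hubbard-h0-rotor-theory-1` g12: THEOREM-L1.md, `PartF.lean`, memo ROTOR-THEORY-12 §178 (L1: NEW — «a corollary nobody wrote down»;
Z⁺: Mattis 1979 / Nishimori 1981 on bipartite graphs).  For the easy-plane XXZ ferromagnet `H(Δ) = xxzHamiltonian 1 (torusGraph 2 L) (−1) Δ` on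
`(ℤ/L)²`, `L` even, `|Δ| < 1`, with sector energies `E(M) = sectorE L Δ M`:

* **`xxz_level_structure`** (one proof, two-block core of `…TransferTwoBlock` fed with the rotated package of `…TransferRotatedPackage`):
  (Z⁺-unique) every eigenvector of `H(Δ)` at `E(0)` is a multiple of the sector-`0` Perron amplitude — the ground state is UNIQUE and lies in
  `Sᶻ_tot = 0`; (Z⁺-strict) `E(0) < E(M)` for every `M ≠ 0`; (L1) `E(1) ≤ E(M)` for every `M ≠ 0`, and `E(1) < E(M)` for `|M| ≥ 2`
  (all `M` carrying a Perron amplitude, i.e. all non-empty sectors);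
* corollaries `groundState_unique_of_even`, `sectorE_zero_lt_of_even`, `sectorE_one_le_of_even`, `sectorE_one_lt_of_even`;
* the theory seat's typed target `SectorOneBelowHigher` (PartF.lean, VERBATIM) and **`sectorOneBelowHigher_holds : |Δ| < 1 → SectorOneBelowHigher Δ`**.

Mechanism (THEOREM-L1.md (B)–(F) in the rotated frame `H ↦ H'(1,Δ,1)`, `Sᶻ_tot ↦ −Sʸ_tot`, `Sʸ_tot ↦ Sˣ_tot`, global flip ↦ parity operator):
the odd parity block's Perron vector `P_o` is pinned to `(Sʸ_tot)² = 1` by the positive pairing with `Sˣ_tot P_e`; a sector-`M` Perron amplitude has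
both parity components non-zero, the even one cannot be a ground vector (killed by `Sʸ_tot` otherwise) and the odd one cannot sit at `E_o` unless
`M² = 1`; `E_o` itself is attained in the sectors `±1`.  Nothing here is a statement about the Hubbard model.  Prover seat `hubbard-h0-rotor-p1` g14.
-/

set_option linter.dupNamespace false
set_option autoImplicit false

noncomputable section

open Finset Matrix
open scoped ComplexOrder
open Literature.MathematicalPhysics.QuantumLattice Literature.MathematicalPhysics.QuantumLattice.SpinOperators
open Literature.Probability.LatticeModels
open Summit.HubbardSuperconductivity.HubbardSuperconductivity.Theorems.AnisotropyChord.InsertionEntropy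
open Summit.HubbardSuperconductivity.HubbardSuperconductivity.Theorems.AnisotropyChord.Tower
open Summit.AtomisticToContinuum.BoseEinsteinCondensation.Theorems.BECStronglyRayleighSectorPerron (torusGraph_connected)

namespace Summit.HubbardSuperconductivity.HubbardSuperconductivity.Theorems.AnisotropyChord.Transfer

variable (L : ℕ) [NeZero L]

/-- **THEOREM L1 on the even torus** (VERBATIM port of the theory seat's typed target `SectorOneBelowHigher`, PartF.lean, g12): the sectors
`M = ±1` lie strictly below every sector `|M| ≥ 2` carrying a Perron amplitude.
[conjecture: theory seat hubbard-h0-rotor-theory-1, cycle 12, THEOREM-L1.md — PROVED on paper; Lean proof `sectorOneBelowHigher_holds` below for `|Δ| < 1`] -/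
def SectorOneBelowHigher (Δ : ℝ) : Prop :=
  ∀ (L : ℕ) [NeZero L], Even L → ∀ (M : ℝ) (a : TensorIndex (TorusSite 2 L) 2 → ℝ),
    IsPerronSectorGroundAmplitude L Δ M a → 2 ≤ |M| → sectorE L Δ 1 < sectorE L Δ M

/-- `E(1) = E(−1)` on an even torus (particle–hole symmetry; both sectors carry Perron amplitudes). [folklore] -/
theorem sectorE_one_eq_neg_one (hL : Even L) {Δ : ℝ} {a₀ : TensorIndex (TorusSite 2 L) 2 → ℝ}
    (ha₀ : IsPerronSectorGroundAmplitude L Δ 0 a₀) : sectorE L Δ 1 = sectorE L Δ (-1) := by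
  obtain ⟨k, hk⟩ := hL
  have hL2 : 2 ≤ L ^ 2 := by
    have h0 : L ≠ 0 := NeZero.ne L
    have : 1 ≤ k := by omega
    nlinarith
  obtain ⟨b₁, hb₁⟩ := exists_perron_nat ha₀ 1 (by omega)
  obtain ⟨bm, hbm⟩ := exists_perron_neg_one ha₀ hL2
  rw [Nat.cast_one] at hb₁
  have h1 := lowestEnergy_neg_le hb₁
  have h2 := lowestEnergy_neg_le hbm
  rw [neg_neg] at h2
  exact le_antisymm h2 h1

/-- **THE LEVEL STRUCTURE OF THE EASY-PLANE XXZ FERROMAGNET ON THE EVEN TORUS (`|Δ| < 1`).**  With `a₀` the sector-`0` Perron amplitude: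
(1) every eigenvector of `H(Δ)` at the energy `E(0)` — which is the ground energy — is a multiple of `a₀` (UNIQUE ground state, in `Sᶻ_tot = 0`);
(2) for every sector `M ≠ 0` carrying a Perron amplitude: `E(0) < E(M)`, `E(1) ≤ E(M)`, and `E(1) < E(M)` whenever `|M| ≥ 2`.
THEOREM Z⁺ + THEOREM L1 of the theory seat (THEOREM-Z.md, THEOREM-L1.md). [folklore] -/
theorem xxz_level_structure (hL : Even L) {Δ : ℝ} (hΔ : |Δ| < 1) {a₀ : TensorIndex (TorusSite 2 L) 2 → ℝ}
    (ha₀ : IsPerronSectorGroundAmplitude L Δ 0 a₀) :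
    (∀ v : TensorIndex (TorusSite 2 L) 2 → ℂ,
        xxzHamiltonian 1 (torusGraph 2 L) (-1) Δ *ᵥ v = ((sectorE L Δ 0 : ℝ) : ℂ) • v → ∃ c : ℂ, v = c • fun σ => (a₀ σ : ℂ)) ∧
    (∀ (M : ℝ) (a : TensorIndex (TorusSite 2 L) 2 → ℝ), IsPerronSectorGroundAmplitude L Δ M a → M ≠ 0 →
        sectorE L Δ 0 < sectorE L Δ M ∧ sectorE L Δ 1 ≤ sectorE L Δ M ∧ (2 ≤ |M| → sectorE L Δ 1 < sectorE L Δ M)) := by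
  obtain ⟨U, hU, hU', hUH, hSz, hSy, hFlip, hEt, hP0, hPsupp, hHP, hYP, hYYX⟩ := exists_rotated_package L hL hΔ ha₀
  -- the rotated-frame operators and their structural properties
  have hΔ1 : -Δ ≤ 1 := by have := (abs_lt.1 hΔ).1; linarith
  have hΔ2 : Δ ≤ 1 := (abs_lt.1 hΔ).2.le
  obtain ⟨hreal, hsymm, hoff⟩ := xyzBondHamiltonian₃_entries (d := 2) L 1 1 Δ 1 hΔ1 hΔ2
  have hHt : (xyzBondHamiltonian₃ (d := 2) L 1 1 Δ 1).IsHermitian := xyzBondHamiltonian₃_isHermitian (d := 2) L 1 1 Δ 1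
  have hpar : ∀ σ τ : TensorIndex (TorusSite 2 L) 2, (∑ z, (σ z : ℕ)) % 2 ≠ (∑ z, (τ z : ℕ)) % 2 →
      xyzBondHamiltonian₃ (d := 2) L 1 1 Δ 1 σ τ = 0 := fun σ τ h => xyzBondHamiltonian₃_one_apply_of_parity_ne (d := 2) L 1 Δ 1 h
  have hflip : ∀ (x y : TorusSite 2 L) (σ : TensorIndex (TorusSite 2 L) 2), (torusGraph 2 L).Adj x y →
      xyzBondHamiltonian₃ (d := 2) L 1 1 Δ 1 σ (flipAt x (flipAt y σ)) ≠ 0 := by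
    intro x y σ hxy
    rw [xyzBondHamiltonian₃_one_apply_doubleFlip (d := 2) L 1 Δ 1 hxy σ, neg_ne_zero, Complex.ofReal_ne_zero]
    have h1 := (abs_lt.1 hΔ).1
    have h2 := (abs_lt.1 hΔ).2
    split_ifs <;> · intro h; linarith
  have hcomm := (HardCoreBoson.commute_xxzHamiltonian_totalSpin_two 1 (torusGraph 2 L) (-1) Δ).eq
  have hHY : xyzBondHamiltonian₃ (d := 2) L 1 1 Δ 1 * (totalSpin 1 1 : Op (TorusSite 2 L) 2) =
      (totalSpin 1 1 : Op (TorusSite 2 L) 2) * xyzBondHamiltonian₃ (d := 2) L 1 1 Δ 1 := by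
    have h2 : (totalSpin 1 1 : Op (TorusSite 2 L) 2) = -(U * (totalSpin 1 2 : Op (TorusSite 2 L) 2) * Uᴴ) := by rw [hSz, neg_neg]
    rw [← hUH, h2, mul_neg, neg_mul, conj_mul_conj hU' _ _, conj_mul_conj hU' _ _, hcomm]
  have hYh : (totalSpin 1 1 : Op (TorusSite 2 L) 2)ᴴ = totalSpin 1 1 := (totalSpin_isHermitian 1 1).eq
  have hYpar : ∀ σ τ : TensorIndex (TorusSite 2 L) 2, (∑ z, (σ z : ℕ)) % 2 = (∑ z, (τ z : ℕ)) % 2 →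
      (totalSpin 1 1 : Op (TorusSite 2 L) 2) σ τ = 0 := fun σ τ h => totalSpin_one_one_apply_of_parity_eq h
  have hX : ∀ (v : TensorIndex (TorusSite 2 L) 2 → ℂ) (τ : TensorIndex (TorusSite 2 L) 2),
      ((totalSpin 1 0 : Op (TorusSite 2 L) 2) *ᵥ v) τ = (∑ x, v (flipAt x τ)) / 2 := totalSpin_one_zero_mulVec
  have hG := torusGraph_connected 2 L
  set x₀ : TorusSite 2 L := fun _ => 0 with hx₀
  set H : Op (TorusSite 2 L) 2 := xxzHamiltonian 1 (torusGraph 2 L) (-1) Δ with hHdef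
  have hH : H.IsHermitian := xxzHamiltonian_isHermitian 1 (torusGraph 2 L) (-1) Δ
  -- back-rotation bookkeeping
  have hHU : H = Uᴴ * xyzBondHamiltonian₃ (d := 2) L 1 1 Δ 1 * U := by
    rw [← hUH]
    calc H = (Uᴴ * U) * H * (Uᴴ * U) := by rw [hU', Matrix.one_mul, Matrix.mul_one]
      _ = Uᴴ * (U * H * Uᴴ) * U := by simp only [Matrix.mul_assoc]
  have hSzU : (totalSpin 1 2 : Op (TorusSite 2 L) 2) = -(Uᴴ * (totalSpin 1 1 : Op (TorusSite 2 L) 2) * U) := by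
    calc (totalSpin 1 2 : Op (TorusSite 2 L) 2) = (Uᴴ * U) * totalSpin 1 2 * (Uᴴ * U) := by
          rw [hU', Matrix.one_mul, Matrix.mul_one]
      _ = Uᴴ * (U * totalSpin 1 2 * Uᴴ) * U := by simp only [Matrix.mul_assoc]
      _ = -(Uᴴ * totalSpin 1 1 * U) := by rw [hSz, Matrix.mul_neg, Matrix.neg_mul, Matrix.mul_assoc]
  have hback : ∀ (p : TensorIndex (TorusSite 2 L) 2 → ℂ) (E : ℝ),
      xyzBondHamiltonian₃ (d := 2) L 1 1 Δ 1 *ᵥ p = (E : ℂ) • p → H *ᵥ (Uᴴ *ᵥ p) = (E : ℂ) • (Uᴴ *ᵥ p) := by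
    intro p E hp
    rw [hHU, Matrix.mulVec_mulVec, Matrix.mul_assoc, Matrix.mul_assoc, hU, Matrix.mul_one, ← Matrix.mulVec_mulVec, hp,
      Matrix.mulVec_smul]
  refine ⟨?_, ?_⟩
  · -- (1) uniqueness
    intro v hv
    have hvt : xyzBondHamiltonian₃ (d := 2) L 1 1 Δ 1 *ᵥ (U *ᵥ v) = ((sectorE L Δ 0 : ℝ) : ℂ) • (U *ᵥ v) := by
      rw [← hUH, conj_mulVec_mulVec hU', hv, Matrix.mulVec_smul]
    obtain ⟨c, hc⟩ := ground_unique_of_twoBlock (torusGraph 2 L) hG x₀ _ _ _ hHt hreal hsymm hoff hpar hflip hHY hYh hYpar hX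
      hEt hP0 hPsupp hHP hYP hYYX hvt
    refine ⟨c, ?_⟩
    have h1 : v = Uᴴ *ᵥ (U *ᵥ v) := by rw [Matrix.mulVec_mulVec, hU', Matrix.one_mulVec]
    rw [h1, hc, Matrix.mulVec_smul, Matrix.mulVec_mulVec, hU', Matrix.one_mulVec]
  · -- (2) energies
    intro M a ha hM
    set ca : TensorIndex (TorusSite 2 L) 2 → ℂ := fun σ => (a σ : ℂ) with hca
    have hHψ : xyzBondHamiltonian₃ (d := 2) L 1 1 Δ 1 *ᵥ (U *ᵥ ca) = ((sectorE L Δ M : ℝ) : ℂ) • (U *ᵥ ca) := by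
      rw [← hUH, conj_mulVec_mulVec hU', ha.eigen, Matrix.mulVec_smul]; rfl
    have hYψ : (totalSpin 1 1 : Op (TorusSite 2 L) 2) *ᵥ (U *ᵥ ca) = (-(M : ℂ)) • (U *ᵥ ca) := by
      have h2 : (totalSpin 1 1 : Op (TorusSite 2 L) 2) = -(U * (totalSpin 1 2 : Op (TorusSite 2 L) 2) * Uᴴ) := by rw [hSz, neg_neg]
      rw [h2, Matrix.neg_mulVec, conj_mulVec_mulVec hU', LiebMattis.totalSpin_two_mulVec_of_mem 1 ha.sector, Matrix.mulVec_smul,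
        neg_smul]
    have hμ : (-(M : ℂ)) ≠ 0 := neg_ne_zero.2 (by exact_mod_cast hM)
    have hψe := parityComponents_ne_zero L hL ha hM hU' hFlip 0 two_pos
    have hψo := parityComponents_ne_zero L hL ha hM hU' hFlip 1 one_lt_two
    obtain ⟨h0lt, hole, holt⟩ := energy_bounds_of_twoBlock (torusGraph 2 L) hG x₀ _ _ _ hHt hreal hsymm hoff hpar hflip hHY hYh
      hYpar hX hEt hP0 hPsupp hHP hYP hYYX hHψ hYψ hμ hψe hψo
    -- `E(1) ≤ E_o`
    obtain ⟨p, hp0, hHp, hYp⟩ := exists_oddGround_Y_eq (torusGraph 2 L) hG x₀ _ _ _ hHt hreal hsymm hoff hpar hflip hHY hYh hYpar hX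
      hEt hP0 hPsupp hHP hYYX
    set Eo : ℝ := (xyzBondHamiltonian₃ (d := 2) L 1 1 Δ 1).minEnergyOn (paritySubmodule (Λ := TorusSite 2 L) 1) with hEo
    have hu0 : Uᴴ *ᵥ p ≠ 0 := mulVec_ne_zero_of_left_inverse (U := Uᴴ) (V := U) hU hp0
    have hHu : H *ᵥ (Uᴴ *ᵥ p) = (Eo : ℂ) • (Uᴴ *ᵥ p) := hback p Eo hHp
    have hsec : ∀ s : ℝ, (totalSpin 1 2 : Op (TorusSite 2 L) 2) *ᵥ (Uᴴ *ᵥ p) = (s : ℂ) • (Uᴴ *ᵥ p) → sectorE L Δ s ≤ Eo := by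
      intro s hs
      have hmem : Uᴴ *ᵥ p ∈ spinZSector (Λ := TorusSite 2 L) 1 s := by
        rw [spinZSector, Module.End.mem_eigenspace_iff, Matrix.toLin'_apply, hs]
      have h := minEnergyOn_mul_le_re_rayleigh hH (spinZSector (Λ := TorusSite 2 L) 1 s) hmem
      rw [hHu, dotProduct_smul, smul_eq_mul, Complex.re_ofReal_mul] at h
      exact le_of_mul_le_mul_right h (EigenvalueContinuation.re_star_dotProduct_self_pos hu0)
    have hSzu : (totalSpin 1 2 : Op (TorusSite 2 L) 2) *ᵥ (Uᴴ *ᵥ p) = -(Uᴴ *ᵥ ((totalSpin 1 1 : Op (TorusSite 2 L) 2) *ᵥ p)) := by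
      rw [hSzU, Matrix.neg_mulVec, Matrix.mulVec_mulVec, Matrix.mul_assoc, Matrix.mul_assoc, hU, Matrix.mul_one, ← Matrix.mulVec_mulVec]
    have h1le : sectorE L Δ 1 ≤ Eo := by
      rcases hYp with hYp | hYp
      · rw [sectorE_one_eq_neg_one L hL ha₀]
        refine hsec (-1) ?_
        rw [hSzu, hYp]; push_cast; rw [neg_one_smul]
      · refine hsec 1 ?_
        rw [hSzu, hYp, Matrix.mulVec_neg, neg_neg]; push_cast; rw [one_smul]
    refine ⟨h0lt, h1le.trans hole, fun h2 => lt_of_le_of_lt h1le (holt ?_)⟩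
    -- `μ² ≠ 1` for `|M| ≥ 2`
    intro hsq
    have h3 : ((M ^ 2 : ℝ) : ℂ) = 1 := by rw [← hsq]; push_cast; ring
    have h4 : M ^ 2 = 1 := by exact_mod_cast h3
    have h5 : |M| ^ 2 = 1 := by rw [sq_abs]; exact h4
    nlinarith [abs_nonneg M]

/-- **THEOREM Z⁺, uniqueness (even torus, `|Δ| < 1`): the ground state of `H(Δ)` is unique and is the sector-`0` Perron amplitude** —
`E(0)` is the ground energy and every eigenvector at `E(0)` is a multiple of `a₀`.  (Also settles the identification caveat of the
`HalfFillingAnchor`: the `β → ∞` state is `|a₀⟩⟨a₀|`.) Mattis 1979 / Nishimori 1981; theory seat THEOREM-Z.md (ii)–(iii). [folklore] -/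
theorem groundState_unique_of_even (hL : Even L) {Δ : ℝ} (hΔ : |Δ| < 1) {a₀ : TensorIndex (TorusSite 2 L) 2 → ℝ}
    (ha₀ : IsPerronSectorGroundAmplitude L Δ 0 a₀) :
    sectorE L Δ 0 = (xxzHamiltonian 1 (torusGraph 2 L) (-1) Δ).minEnergyOn ⊤ ∧
    ∀ v : TensorIndex (TorusSite 2 L) 2 → ℂ,
      xxzHamiltonian 1 (torusGraph 2 L) (-1) Δ *ᵥ v = ((sectorE L Δ 0 : ℝ) : ℂ) • v → ∃ c : ℂ, v = c • fun σ => (a₀ σ : ℂ) :=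
  ⟨(sectorE_zero_eq_minEnergyOn L hL hΔ ha₀).1, (xxz_level_structure L hL hΔ ha₀).1⟩

/-- **THEOREM Z⁺, strict form (even torus, `|Δ| < 1`): `E(0) < E(M)` for every sector `M ≠ 0` carrying a Perron amplitude.** [folklore] -/
theorem sectorE_zero_lt_of_even (hL : Even L) {Δ : ℝ} (hΔ : |Δ| < 1) {M : ℝ} {a : TensorIndex (TorusSite 2 L) 2 → ℝ}
    (ha : IsPerronSectorGroundAmplitude L Δ M a) (hM : M ≠ 0) : sectorE L Δ 0 < sectorE L Δ M := by
  obtain ⟨a₀, ha₀⟩ := exists_perron_zero_of_even Δ hL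
  exact ((xxz_level_structure L hL hΔ ha₀).2 M a ha hM).1

/-- **THEOREM L1, weak form: `E(1) ≤ E(M)` for every `M ≠ 0`** (the odd parity block's minimum is `E(±1)`). [folklore] -/
theorem sectorE_one_le_of_even (hL : Even L) {Δ : ℝ} (hΔ : |Δ| < 1) {M : ℝ} {a : TensorIndex (TorusSite 2 L) 2 → ℝ}
    (ha : IsPerronSectorGroundAmplitude L Δ M a) (hM : M ≠ 0) : sectorE L Δ 1 ≤ sectorE L Δ M := by
  obtain ⟨a₀, ha₀⟩ := exists_perron_zero_of_even Δ hL
  exact ((xxz_level_structure L hL hΔ ha₀).2 M a ha hM).2.1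

/-- **THEOREM L1 (theory seat g12, THEOREM-L1.md): `E(1) < E(M)` for every `|M| ≥ 2` carrying a Perron amplitude** (even torus, `|Δ| < 1`).
[folklore] -/
theorem sectorE_one_lt_of_even (hL : Even L) {Δ : ℝ} (hΔ : |Δ| < 1) {M : ℝ} {a : TensorIndex (TorusSite 2 L) 2 → ℝ}
    (ha : IsPerronSectorGroundAmplitude L Δ M a) (hM : 2 ≤ |M|) : sectorE L Δ 1 < sectorE L Δ M := by
  obtain ⟨a₀, ha₀⟩ := exists_perron_zero_of_even Δ hL
  have hM0 : M ≠ 0 := by intro h; rw [h, abs_zero] at hM; linarith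
  exact ((xxz_level_structure L hL hΔ ha₀).2 M a ha hM0).2.2 hM

/-- **THEOREM L1 HOLDS**: `SectorOneBelowHigher Δ` for every `|Δ| < 1`. [conjecture: theory seat hubbard-h0-rotor-theory-1, cycle 12,
THEOREM-L1.md — THEOREM L1; Lean proof here] -/
theorem sectorOneBelowHigher_holds {Δ : ℝ} (hΔ : |Δ| < 1) : SectorOneBelowHigher Δ :=
  fun L _ hL _ _ ha hM => sectorE_one_lt_of_even L hL hΔ ha hM

end Summit.HubbardSuperconductivity.HubbardSuperconductivity.Theorems.AnisotropyChord.Transfer
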